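import Mathlib
import HarnessLib
import Literature.Barriers.Schanuel.AlgebraicIndependenceOfLogarithms
import Summits.Schanuel.Schanuel.Theses.DiophantineDichotomy
import Summits.Schanuel.Schanuel.Theorems.DiophantineDichotomyApproximationRace

/-!
# Route `DiophantineDichotomy` — the `n = 2` race `EPiRace` (stmt-Schanuel-11044)

`Summit.Schanuel.Schanuel.Theses.DiophantineDichotomy.EPiRace` is the support item of route
`DiophantineDichotomy` racing, at the point `θ = (π, e) ∈ ℂ²`, the level-1 approximation property
(hypothesis: for `trdeg_ℚ ℚ(π, e) ≤ 1` there is `c ≥ 1` such that for all `Y ≥ Δ ≥ c` some algebraic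
`γ ∈ ℂ²` with `[ℚ(γ):ℚ] ≤ d ≤ cΔ`, coordinates roots of non-zero integer polynomials of degree `≤ d`
and height `≤ H`, `log H ≤ cY`, satisfies `‖γ − θ‖ ≤ exp(−(Δ log H + dY)/c)`) against the crux
`EPiSimultaneousType` (`‖γ − θ‖ ≥ exp(−C(dᵃ log H + dᵇ))` with `a < 1`), to conclude that `e` and `π`
are algebraically independent over `ℚ`.

Proof (as in the item text). Suppose `![e, π]` is NOT algebraically independent over `ℚ` (in `ℝ`).
Then `trdeg_ℚ ℚ(π, e) ≤ 1`: otherwise `trdeg ≥ 2` and `![π, e]` would be a transcendence basis of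
`ℚ(π, e)`, hence algebraically independent in `ℂ`
(`Literature.Barriers.Schanuel.algebraicIndependent_of_le_trdeg_adjoin`), and algebraic independence
transfers along the injective `ℚ`-algebra map `ℝ → ℂ` and the swap of coordinates. So the hypothesis
applies; the measure and the approximation give `Δ log H + dY ≤ cC(dᵃ log H + dᵇ)` with `1 ≤ d ≤ cΔ`,
`H ≥ 1`, which is impossible at the scales `(Δ, Y)` of the already-landed race lemma
`Summit.Schanuel.Schanuel.Theorems.ApproximationRace.race` (case `t = 1`, `a < 1/1`).

No new definitions; inputs: the landed `ApproximationRace` helpers and the folklore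
`trdeg ≥ n ⇒ algebraic independence` lemma of the barrier catalogue file.
-/

-- `Summit.Schanuel.Schanuel.…` is the mandated summit/sub-problem namespace (single-conjunct summit), hence:
set_option linter.dupNamespace false

namespace Summit.Schanuel.Schanuel.Theorems

open Summit.Schanuel.Schanuel.Theses.DiophantineDichotomy

/-- If `e, π` are NOT algebraically independent over `ℚ` (as real numbers), then
`trdeg_ℚ ℚ(π, e) ≤ 1` (as a subfield of `ℂ`): otherwise `(π, e)` is a transcendence basis of
`ℚ(π, e)`, so algebraically independent in `ℂ`, and this transfers to `ℝ` along the injective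
`ℚ`-algebra map `ℝ → ℂ` (and the swap of the two coordinates). [folklore] -/
theorem EPiRace.trdeg_le_one_of_not_algebraicIndependent
    (hnot : ¬ AlgebraicIndependent ℚ ![Real.exp 1, Real.pi]) :
    Algebra.trdeg ℚ ↥(IntermediateField.adjoin ℚ (Set.range ![(Real.pi : ℂ), (Real.exp 1 : ℂ)]))
      ≤ (1 : Cardinal) := by
  by_contra hlt
  have h2 : ((2 : ℕ) : Cardinal) ≤
      Algebra.trdeg ℚ ↥(IntermediateField.adjoin ℚ (Set.range ![(Real.pi : ℂ), (Real.exp 1 : ℂ)])) := by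
    have h2' : (2 : Cardinal) ≤ _ := Cardinal.two_le_iff_one_lt.mpr (not_le.mp hlt)
    exact_mod_cast h2'
  have hθ : AlgebraicIndependent ℚ ![(Real.pi : ℂ), (Real.exp 1 : ℂ)] :=
    Literature.Barriers.Schanuel.algebraicIndependent_of_le_trdeg_adjoin _ h2
  have hswap : AlgebraicIndependent ℚ (![(Real.pi : ℂ), (Real.exp 1 : ℂ)] ∘ ![(1 : Fin 2), 0]) :=
    hθ.comp _ (by decide)
  let f : ℝ →ₐ[ℚ] ℂ := Complex.ofRealAm.restrictScalars ℚ
  have hf : Function.Injective f := Complex.ofReal_injective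
  have heq : f ∘ ![Real.exp 1, Real.pi] = ![(Real.pi : ℂ), (Real.exp 1 : ℂ)] ∘ ![(1 : Fin 2), 0] := by
    ext i
    fin_cases i <;> simp [f]
  apply hnot
  rw [← AlgHom.algebraicIndependent_iff f hf, heq]
  exact hswap

/-- **`EPiRace`** (route `DiophantineDichotomy`, support item stmt-Schanuel-11044): the level-1
approximation property at `θ = (π, e)` (under `trdeg_ℚ ℚ(π, e) ≤ 1`) and the simultaneous
approximation measure `EPiSimultaneousType` (degree exponent `a < 1`) imply that `e` and `π` are
algebraically independent over `ℚ`: if not, `trdeg_ℚ ℚ(π, e) ≤ 1`, and at the scales `(Δ, Y)` of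
`ApproximationRace.race` (`t = 1`) the approximant `γ` (with `1 ≤ d ≤ cΔ`, `H ≥ 1`) would satisfy
both `‖γ − θ‖ ≥ exp(−C(dᵃ log H + dᵇ))` and `‖γ − θ‖ ≤ exp(−(Δ log H + dY)/c)`, i.e.
`Δ log H + dY ≤ cC(dᵃ log H + dᵇ)`, contradicting the race. [folklore] -/
theorem ePiRace_proof : EPiRace := by
  intro hAP hAT
  by_contra hnot
  obtain ⟨c, hc1, hAP'⟩ := hAP (EPiRace.trdeg_le_one_of_not_algebraicIndependent hnot)
  obtain ⟨a, b, C, ha, hC, hAT'⟩ := hAT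
  have ha' : a < 1 / ((1 : ℕ) : ℝ) := by rw [Nat.cast_one, div_one]; exact ha
  obtain ⟨Δ, Y, hcΔ, hΔY, hrace⟩ := ApproximationRace.race (t := 1) le_rfl hc1 hC ha'
  obtain ⟨γ, d, H, hfin, hpoly, hd, -, hdist⟩ := hAP' Δ Y hcΔ hΔY
  have hlow := hAT' d H γ hfin hpoly
  obtain ⟨P, hP0, hPdeg, hPH, hPz⟩ := hpoly 0
  have h1d : 1 ≤ d := ApproximationRace.one_le_of_root hP0 hPdeg hPz
  have h1H : 1 ≤ H := ApproximationRace.one_le_height hP0 hPH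
  have hcpos : (0 : ℝ) < c := lt_of_lt_of_le one_pos hc1
  have hd' : (d : ℝ) ≤ (c * Δ) ^ (1 : ℕ) := by rw [pow_one]; exact hd
  have hsand := Real.exp_le_exp.mp (hlow.trans hdist)
  -- `-(C·(…)) ≤ -((log H Δ + d Y)/c)`
  have hineq : Real.log H * Δ + d * Y ≤ c * (C * ((d : ℝ) ^ a * Real.log H + (d : ℝ) ^ b)) := by
    have := neg_le_neg hsand
    rw [neg_neg, neg_neg, div_le_iff₀ hcpos] at this
    linarith
  exact absurd hineq (not_le.mpr (hrace d H h1d h1H hd'))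

end Summit.Schanuel.Schanuel.Theorems
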